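import Literature.NumberTheory.Transcendental.Analytification
import Literature.NumberTheory.Transcendental.AnalytificationSecondCountableProofs
import Literature.AlgebraicGeometry.Motives.AlgPointsProperProofs
import HarnessLib

/-!
# Analytifications of proper schemes are compact and second countable (proof file)

Topic: the analytification predicate `Literature.NumberTheory.Transcendental.IsAnalytification`
of `Literature/NumberTheory/Transcendental/Analytification.lean` (Serre, *GAGA*, §2). That file
states, as NAMED FACTS (D-0014) with their interim proofs preserved in comments,

* `Literature.NumberTheory.Transcendental.IsAnalytification.compactSpace`: an analytification
  `φ : M → X(ℂ)` of a proper `k`-scheme `X` (`k ⊆ ℂ`) has compact source `M`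
  [SGA1, Exp. XII, Prop. 3.2 (v); Serre, GAGA §2 n°7, Prop. 6];
* `Literature.NumberTheory.Transcendental.IsAnalytification.secondCountableTopology`: an
  analytification of a `k`-scheme of finite type (locally of finite type with quasi-compact
  underlying space) is second countable [Serre, GAGA §2 n°5, p. 9].

Both were demoted to facts by the M5 import only because their one-line proofs used results that
were themselves named facts at the time. Those inputs are now PROVED in the tree:
`Literature.AlgebraicGeometry.Motives.compactSpace_algPoints_of_isProper_holds`
(`Motives/AlgPointsProperProofs.lean`: `X(L)` is compact for `X` proper and `L` locally compact) and
`Literature.AlgebraicGeometry.Motives.ComplexPoints.secondCountableTopology_of_compactSpace_holds`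
(`Transcendental/AnalytificationSecondCountableProofs.lean`). This file **discharges** the two
facts by transporting along the homeomorphism `IsAnalytification.homeomorph : M ≃ₜ X(ℂ)` — exactly
the preserved interim proofs. Nothing new is defined.

## Main statements

* `Literature.NumberTheory.Transcendental.IsAnalytification.compactSpace_holds`
* `Literature.NumberTheory.Transcendental.IsAnalytification.secondCountableTopology_holds`
* usable corollaries `IsAnalytification.compactSpace_of_isProper`,
  `IsAnalytification.secondCountableTopology_of_compactSpace` (instance hypotheses of the facts
  supplied from the context).

## References

* J.-P. Serre, *Géométrie algébrique et géométrie analytique*, Ann. Inst. Fourier **6** (1956),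
  §2, n°5 (p. 9, "dénombrable à l'infini") and n°7, Prop. 6 (`X` complète ⇔ `X^h` compacte).
* A. Grothendieck, M. Raynaud, *SGA 1*, Exp. XII, Prop. 3.2 (v).
-/

noncomputable section

open scoped Manifold

namespace Literature.NumberTheory.Transcendental

namespace IsAnalytification

variable {E : Type*} [NormedAddCommGroup E] [NormedSpace ℂ E] [FiniteDimensional ℂ E]
  {M : Type*} [TopologicalSpace M] [ChartedSpace E M]
  {k : Type} [Field k] [Algebra k ℂ] {X : Literature.AlgebraicGeometry.Motives.SchemeOver k} {d : ℕ}
  {φ : M → Literature.AlgebraicGeometry.Motives.ComplexPoints X}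

/-- An analytification `φ : M → X(ℂ)` of a PROPER `k`-scheme has compact source: `X(ℂ)` is compact
(`Literature.AlgebraicGeometry.Motives.compactSpace_algPoints_of_isProper_holds`, Serre GAGA §2
Prop. 6 / SGA1 XII Prop. 3.2 (v)) and `φ` is a homeomorphism onto it. Usable form of the named fact
`IsAnalytification.compactSpace`, with `[IsProper X.hom]` taken from the context.
[cite: SerreGAGA1956, §2 n°7 Prop. 6] [cite: SGA1, Exp. XII Prop. 3.2 (v)] -/
theorem compactSpace_of_isProper [AlgebraicGeometry.IsProper X.hom] (hφ : IsAnalytification E X d φ) :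
    CompactSpace M := by
  haveI : CompactSpace (Literature.AlgebraicGeometry.Motives.ComplexPoints X) :=
    Literature.AlgebraicGeometry.Motives.compactSpace_algPoints_of_isProper_holds X ℂ
  exact hφ.homeomorph.symm.compactSpace

/-- **Discharge of the named fact `IsAnalytification.compactSpace`** (`Analytification.lean`): an
analytification of a proper `k`-scheme is compact — Serre, GAGA §2 n°7, Prop. 6 («pour que `X` soit
complète, il faut et il suffit que `X^h` soit compacte», direction ⇒); SGA1 XII Prop. 3.2 (v).
[cite: SerreGAGA1956, §2 n°7 Prop. 6] [cite: SGA1, Exp. XII Prop. 3.2 (v)] -/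
theorem compactSpace_holds : IsAnalytification.compactSpace (E := E) (X := X) (d := d) (φ := φ) :=
  fun hφ ↦ hφ.compactSpace_of_isProper

/-- An analytification `φ : M → X(ℂ)` of a `k`-scheme of finite type (locally of finite type,
quasi-compact underlying space) has second-countable source: `X(ℂ)` is second countable
(`Literature.AlgebraicGeometry.Motives.ComplexPoints.secondCountableTopology_of_compactSpace_holds`,
Serre GAGA §2 n°5) and `φ` is a homeomorphism onto it. Usable form of the named fact
`IsAnalytification.secondCountableTopology`, with the instance hypotheses taken from the context.
[cite: SerreGAGA1956, §2 n°5 p. 9] -/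
theorem secondCountableTopology_of_compactSpace [AlgebraicGeometry.LocallyOfFiniteType X.hom]
    [CompactSpace X.left] (hφ : IsAnalytification E X d φ) : SecondCountableTopology M := by
  haveI : SecondCountableTopology (Literature.AlgebraicGeometry.Motives.ComplexPoints X) :=
    Literature.AlgebraicGeometry.Motives.ComplexPoints.secondCountableTopology_of_compactSpace_holds X
  exact hφ.homeomorph.secondCountableTopology

/-- **Discharge of the named fact `IsAnalytification.secondCountableTopology`**
(`Analytification.lean`): an analytification of a `k`-scheme of finite type is second countable —
Serre, GAGA §2 n°5, p. 9 («`X^h` est un espace localement compact dénombrable à l'infini»).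
[cite: SerreGAGA1956, §2 n°5 p. 9] -/
theorem secondCountableTopology_holds :
    IsAnalytification.secondCountableTopology (E := E) (X := X) (d := d) (φ := φ) :=
  fun hφ ↦ hφ.secondCountableTopology_of_compactSpace

end IsAnalytification

end Literature.NumberTheory.Transcendental

end
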